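import Summits.AtomisticToContinuum.BoseEinsteinCondensation.Theorems.BECThomsonPrincipleDensityResponseDefs
import Literature.MathematicalPhysics.QuantumManyBody.PeriodicBoseGasScattering
import Literature.MathematicalPhysics.QuantumManyBody.BoseGasDirichletWall
import Literature.MathematicalPhysics.QuantumManyBody.OneBodyCurrentGain

/-!
# Route `BECThomsonPrinciple`, crux `DensityResponse` (stmt-AtomisticToContinuum-9481),
# line `force-balance-constitutive` — stubs `stub_kineticSignCoherenceBounded` (S3a) and
# `stub_kineticSignCoherenceUnbounded` (S3b)

The registered stubs S3a `stub_kineticSignCoherenceBounded : KineticSignCoherenceBounded` and S3b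
`stub_kineticSignCoherenceUnbounded : KineticSignCoherenceUnbounded` of the skeleton
`Cruxes/DensityResponse/Lines/force-balance-constitutive.lean` (statements in
`Theorems/BECThomsonPrincipleDensityResponseDefs.lean`): kinetic sign-coherence
`-C'·s·N ≤ K_k(Φ) + I_k(Φ)` of finite-energy transport-stationary sub-ground states at super-healing
drives `s ≥ ρ·a(v)`, for bounded potentials `v` (S3a) and, uniformly in the truncation height, for
the truncations `v_t = min(v, t)` of unbounded ones (S3b).

Read literally, both reduce to two elementary cases of the scattering length `a(v)` (finite for
finite range, `scatteringLength_ne_top_of_finiteRange`):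

* `a(v) > 0`: the registered sub-goal `stub_kinIneqOfPos` of the `Defs` file (stationarity
  `K + I = s·N_eff − (|k|²/4)m`, `N_eff ≥ 0`, `|m| ≤ 2N`, the window and the floor `ρ ≤ s/a`), with
  `C' = 3M²/(2a)`, for `v` and for every `v_t` alike.
* `a(v) = 0`: by LSSY App. C (`LSSY2005_zeroScatteringLength_holds`) `v(|x|) = 0` for a.e.
  `x ∈ ℝ³`, hence (pulling null sets back along the surjective linear maps `X ↦ xᵢ - xⱼ`,
  `ae_comp_linearMap_mem_iff`) the periodised interaction vanishes for a.e. configuration, for `v`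
  and for every `v_t ≤ v`. Then the virial wave `I_k` vanishes, `E_v(Φ) = T(Φ)` is the kinetic
  energy, `E₀^per(v) = E₀^per(0) = 0` (`periodicGroundStateEnergy_zero_eq_zero`), the sub-ground
  condition reads `T(Φ) ≤ s·m(Φ) ≤ 2sN`, and `|K_k(Φ)| ≤ 2T(Φ)` pointwise by Cauchy–Schwarz in the
  three coordinates of `k·∇ᵢ` (`|k·∇ᵢΦ|²/|k|² ≤ ∑_c |∂_{i,c}Φ|²`, `|cos| ≤ 1`); so `C' = 4` works.

No virial domination and no Dyson upper bound are needed for the literal statements.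

References: Lieb–Seiringer–Solovej–Yngvason, *The Mathematics of the Bose Gas and its
Condensation* (2005), App. C, Thm. C.1 (zero scattering length); the stress/virial bookkeeping is
the `Defs` file's.
-/

namespace Summit.AtomisticToContinuum.BoseEinsteinCondensation.Cruxes.DensityResponse.ForceBalanceConstitutive

open MeasureTheory
open scoped ENNReal
open Literature.MathematicalPhysics.QuantumManyBody.BoseGas

noncomputable section

variable {N : ℕ} {L : ℝ}

/-! ### Interaction-free potentials: `w(|x|) = 0` a.e. -/

/-- For `i ≠ j` and `c ∈ ℝ³`: if `w(|x|) = 0` for a.e. `x ∈ ℝ³` then `w(|xᵢ - xⱼ - c|) = 0` for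
a.e. configuration `X ∈ (ℝ³)^N` (translation invariance of Lebesgue measure and
`ae_comp_linearMap_mem_iff` for the surjective linear map `X ↦ xᵢ - xⱼ`). [folklore] -/
theorem ae_pair_eq_zero {w : ℝ → ℝ≥0∞} (hw : Measurable w) (hw0 : ∀ᵐ x : Space, w ‖x‖ = 0)
    {i j : Fin N} (hij : i ≠ j) (c : Space) :
    ∀ᵐ X : Config N, w ‖X i - X j - c‖ = 0 := by
  have hc : ∀ᵐ y : Space, w ‖y - c‖ = 0 :=
    (measurePreserving_sub_right (volume : Measure Space) c).quasiMeasurePreserving.ae hw0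
  have hs : MeasurableSet {y : Space | w ‖y - c‖ = 0} :=
    hw.comp (measurable_id.sub_const c).norm (measurableSet_singleton 0)
  let T : Config N →ₗ[ℝ] Space :=
    LinearMap.proj (R := ℝ) (φ := fun _ : Fin N => Space) i -
      LinearMap.proj (R := ℝ) (φ := fun _ : Fin N => Space) j
  have hT : Function.Surjective T := fun y =>
    ⟨Pi.single i y, by simp [T, Pi.single_eq_of_ne hij.symm]⟩
  have h := (ae_comp_linearMap_mem_iff T volume volume hT hs).2 hc
  filter_upwards [h] with X hX
  simpa [T] using hX

/-- If `w(|x|) = 0` for a.e. `x ∈ ℝ³`, the periodised interaction `∑_{i<j} w^per(xᵢ - xⱼ)` vanishes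
for a.e. configuration (countably many pairs and lattice images). [folklore] -/
theorem periodicInteraction_ae_eq_zero {w : ℝ → ℝ≥0∞} (hw : Measurable w)
    (hw0 : ∀ᵐ x : Space, w ‖x‖ = 0) (N : ℕ) (L : ℝ) :
    ∀ᵐ X : Config N, periodicInteraction w L X = 0 := by
  have h : ∀ᵐ X : Config N, ∀ i j : Fin N, i ≠ j → ∀ m : Fin 3 → ℤ,
      w ‖X i - X j - latticeVec L m‖ = 0 := by
    refine ae_all_iff.2 fun i => ae_all_iff.2 fun j => ?_
    by_cases hij : i = j
    · exact Filter.Eventually.of_forall fun X h => absurd hij h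
    · have h' := ae_all_iff.2 fun m : Fin 3 → ℤ => ae_pair_eq_zero hw hw0 hij (latticeVec L m)
      exact h'.mono fun X hX _ => hX
  refine h.mono fun X hX => ?_
  unfold periodicInteraction periodizedPotential
  refine Finset.sum_eq_zero fun i _ => Finset.sum_eq_zero fun j hj => ?_
  exact ENNReal.tsum_eq_zero.2 fun m => hX i j (Finset.mem_filter.1 hj).2.ne m

/-- If `w(|x|) = 0` a.e., the periodic energy is the kinetic energy: `E_w(Ψ) = T(Ψ)`
(`cellKineticEnergy`). [folklore] -/
theorem periodicEnergy_eq_ofReal_of_ae {w : ℝ → ℝ≥0∞} (hw : Measurable w)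
    (hw0 : ∀ᵐ x : Space, w ‖x‖ = 0) (Ψ : PeriodicTrialState N L) :
    periodicEnergy w Ψ = ENNReal.ofReal (cellKineticEnergy L Ψ.ψ) := by
  rw [← lintegral_kineticDensity_eq Ψ.contDiff L]
  unfold periodicEnergy
  refine lintegral_congr_ae ?_
  filter_upwards [ae_restrict_of_ae (s := cellN N L) (periodicInteraction_ae_eq_zero hw hw0 N L)]
    with X hX
  rw [hX, zero_mul, add_zero]

/-- If `w(|x|) = 0` a.e., the periodic ground-state energy vanishes (it is that of the free gas,
`periodicGroundStateEnergy_zero_eq_zero`). [folklore] -/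
theorem periodicGroundStateEnergy_eq_zero_of_ae {w : ℝ → ℝ≥0∞} (hw : Measurable w)
    (hw0 : ∀ᵐ x : Space, w ‖x‖ = 0) (N : ℕ) (hL : 0 < L) :
    periodicGroundStateEnergy w N L = 0 := by
  rw [← periodicGroundStateEnergy_zero_eq_zero N hL]
  unfold periodicGroundStateEnergy
  refine iInf_congr fun Ψ => ?_
  rw [periodicEnergy_eq_ofReal_of_ae hw hw0 Ψ,
    periodicEnergy_eq_ofReal_of_ae (w := 0) measurable_const
      (Filter.Eventually.of_forall fun _ => rfl) Ψ]

/-- If `w(|x|) = 0` a.e., the virial wave vanishes: `I_k(Φ) = 0` (its integrand carries the factor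
`∑_{i<j} w^per(xᵢ - xⱼ)`). [folklore] -/
theorem virialWave_eq_zero_of_ae {w : ℝ → ℝ≥0∞} (hw : Measurable w)
    (hw0 : ∀ᵐ x : Space, w ‖x‖ = 0) (n : Fin 3 → ℤ) (Φ : PeriodicTrialState N L) :
    virialWave w n Φ = 0 := by
  unfold virialWave
  refine integral_eq_zero_of_ae ?_
  filter_upwards [ae_restrict_of_ae (s := cellN N L) (periodicInteraction_ae_eq_zero hw hw0 N L)]
    with X hX
  simp only [hX, ENNReal.toReal_zero, zero_mul, Pi.zero_apply]

/-! ### The kinetic stress wave is dominated by twice the kinetic energy -/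

/-- `k = ∑_c k_c e_c` with `k_c = 2πn_c/L`. [folklore] -/
theorem kvec_eq_sum (L : ℝ) (n : Fin 3 → ℤ) :
    kvec L n = ∑ c : Fin 3, (2 * Real.pi / L * (n c : ℝ)) • EuclideanSpace.single c (1 : ℝ) := by
  conv_lhs => rw [← (EuclideanSpace.basisFun (Fin 3) ℝ).sum_repr (kvec L n)]
  refine Finset.sum_congr rfl fun c _ => ?_
  rw [EuclideanSpace.basisFun_apply]
  rfl

/-- `k·∇ᵢ g = ∑_c k_c ∂_{i,c} g` (linearity of the Fréchet derivative). [folklore] -/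
theorem kDeriv_eq_sum (L : ℝ) (n : Fin 3 → ℤ) (g : Config N → ℂ) (X : Config N) (i : Fin N) :
    kDeriv L n g X i = ∑ c : Fin 3, (2 * Real.pi / L * (n c : ℝ)) •
      fderiv ℝ g X (Pi.single i (EuclideanSpace.single c (1 : ℝ))) := by
  let φ : Space →ₗ[ℝ] ℂ :=
    (fderiv ℝ g X : Config N →ₗ[ℝ] ℂ).comp (LinearMap.single ℝ (fun _ : Fin N => Space) i)
  have hφ : ∀ y : Space, φ y = fderiv ℝ g X (Pi.single i y) := fun _ => rfl
  calc kDeriv L n g X i = φ (kvec L n) := (hφ _).symm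
    _ = ∑ c : Fin 3, (2 * Real.pi / L * (n c : ℝ)) • φ (EuclideanSpace.single c (1 : ℝ)) := by
        rw [kvec_eq_sum, map_sum]
        simp only [map_smul]
    _ = _ := by simp only [hφ]

/-- Finite Cauchy–Schwarz for a real combination of complex numbers:
`|∑ a_c z_c|² ≤ (∑ a_c²)(∑ |z_c|²)`. [folklore] -/
theorem norm_sum_smul_sq_le {ι : Type*} (s : Finset ι) (a : ι → ℝ) (z : ι → ℂ) :
    ‖∑ c ∈ s, a c • z c‖ ^ 2 ≤ (∑ c ∈ s, a c ^ 2) * ∑ c ∈ s, ‖z c‖ ^ 2 := by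
  have h1 : ‖∑ c ∈ s, a c • z c‖ ≤ ∑ c ∈ s, |a c| * ‖z c‖ :=
    (norm_sum_le _ _).trans (le_of_eq (Finset.sum_congr rfl fun c _ => by
      rw [norm_smul, Real.norm_eq_abs]))
  calc ‖∑ c ∈ s, a c • z c‖ ^ 2 ≤ (∑ c ∈ s, |a c| * ‖z c‖) ^ 2 :=
        pow_le_pow_left₀ (norm_nonneg _) h1 2
    _ ≤ (∑ c ∈ s, |a c| ^ 2) * ∑ c ∈ s, ‖z c‖ ^ 2 := Finset.sum_mul_sq_le_sq_mul_sq s _ _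
    _ = (∑ c ∈ s, a c ^ 2) * ∑ c ∈ s, ‖z c‖ ^ 2 := by simp only [sq_abs]

/-- `|k|² ≥ 0`. [folklore] -/
theorem ksq_nonneg (L : ℝ) (n : Fin 3 → ℤ) : 0 ≤ ksq L n := by
  unfold ksq; positivity

/-- `|k·∇ᵢ g|² ≤ |k|² ∑_c |∂_{i,c} g|²` (Cauchy–Schwarz in the three coordinates). [folklore] -/
theorem norm_kDeriv_sq_le (L : ℝ) (n : Fin 3 → ℤ) (g : Config N → ℂ) (X : Config N) (i : Fin N) :
    ‖kDeriv L n g X i‖ ^ 2 ≤ ksq L n *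
      ∑ c : Fin 3, ‖fderiv ℝ g X (Pi.single i (EuclideanSpace.single c (1 : ℝ)))‖ ^ 2 := by
  have hk : ksq L n = ∑ c : Fin 3, (2 * Real.pi / L * (n c : ℝ)) ^ 2 := by
    unfold ksq
    rw [Finset.mul_sum]
    exact Finset.sum_congr rfl fun c _ => by ring
  rw [kDeriv_eq_sum, hk]
  exact norm_sum_smul_sq_le _ _ _

/-- Pointwise domination of the stress integrand: `|∑ᵢ 2cos θᵢ |k·∇ᵢg|²/|k|²| ≤ 2|∇g|²`.
[folklore] -/
theorem abs_stressIntegrand_le (n : Fin 3 → ℤ) (g : Config N → ℂ) (X : Config N) :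
    |∑ i, 2 * Real.cos (phase L n X i) * (‖kDeriv L n g X i‖ ^ 2 / ksq L n)| ≤
      2 * kineticDensityReal g X := by
  unfold kineticDensityReal
  rw [Finset.mul_sum]
  refine (Finset.abs_sum_le_sum_abs _ _).trans (Finset.sum_le_sum fun i _ => ?_)
  have hq0 : 0 ≤ ‖kDeriv L n g X i‖ ^ 2 / ksq L n := div_nonneg (sq_nonneg _) (ksq_nonneg L n)
  have hq : ‖kDeriv L n g X i‖ ^ 2 / ksq L n ≤
      ∑ c : Fin 3, ‖fderiv ℝ g X (Pi.single i (EuclideanSpace.single c (1 : ℝ)))‖ ^ 2 :=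
    div_le_of_le_mul₀ (ksq_nonneg L n) (Finset.sum_nonneg fun c _ => sq_nonneg _)
      (by rw [mul_comm]; exact norm_kDeriv_sq_le L n g X i)
  calc |2 * Real.cos (phase L n X i) * (‖kDeriv L n g X i‖ ^ 2 / ksq L n)|
      = 2 * |Real.cos (phase L n X i)| * (‖kDeriv L n g X i‖ ^ 2 / ksq L n) := by
        rw [abs_mul, abs_mul, abs_of_nonneg hq0, abs_two]
    _ ≤ 2 * 1 * (‖kDeriv L n g X i‖ ^ 2 / ksq L n) := by
        gcongr
        exact Real.abs_cos_le_one _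
    _ ≤ 2 * ∑ c : Fin 3, ‖fderiv ℝ g X (Pi.single i (EuclideanSpace.single c (1 : ℝ)))‖ ^ 2 := by
        rw [mul_one]
        exact mul_le_mul_of_nonneg_left hq (by norm_num)

/-- `|K_k(Φ)| ≤ 2T(Φ)`: the kinetic stress wave is dominated by twice the kinetic energy.
[folklore] -/
theorem abs_kineticStressWave_le (n : Fin 3 → ℤ) (Φ : PeriodicTrialState N L) :
    |kineticStressWave n Φ| ≤ 2 * cellKineticEnergy L Φ.ψ := by
  unfold kineticStressWave cellKineticEnergy
  have hint : Integrable (fun X => 2 * kineticDensityReal Φ.ψ X) (volume.restrict (cellN N L)) :=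
    (integrableOn_cellN (continuous_kineticDensityReal Φ.contDiff) L).const_mul 2
  rw [← integral_const_mul, ← Real.norm_eq_abs]
  refine norm_integral_le_of_norm_le hint (Filter.Eventually.of_forall fun X => ?_)
  rw [Real.norm_eq_abs]
  exact abs_stressIntegrand_le n Φ.ψ X

/-! ### Kinetic sign-coherence for interaction-free potentials, and the two stubs -/

/-- **Kinetic sign-coherence for an interaction-free potential.** If `w` is measurable with
`w(|x|) = 0` for a.e. `x`, then `KinIneq w a M ρ₀ 4 N₀` for all parameters: on a sub-ground state
`T(Φ) ≤ s·m(Φ) ≤ 2sN` (`E_w = T`, `E₀ = 0`, `|m| ≤ 2N`), `I_k = 0` and `K_k ≥ -2T ≥ -4sN`.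
[folklore] -/
theorem kinIneq_of_ae_zero {w : ℝ → ℝ≥0∞} (hw : Measurable w) (hw0 : ∀ᵐ x : Space, w ‖x‖ = 0)
    (a M ρ₀ : ℝ) (N₀ : ℕ) : KinIneq w a M ρ₀ 4 N₀ := by
  intro N _ L hL _ n _ _ s hs _ Φ _ _ hsub
  rw [virialWave_eq_zero_of_ae hw hw0 n Φ, add_zero]
  rw [periodicGroundStateEnergy_eq_zero_of_ae hw hw0 N hL, ENNReal.toReal_zero,
    periodicEnergy_eq_ofReal_of_ae hw hw0 Φ,
    ENNReal.toReal_ofReal (cellKineticEnergy_nonneg L Φ.ψ)] at hsub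
  have hm : sourceMean n Φ ≤ 2 * N := (le_abs_self _).trans (abs_sourceMean_le n Φ)
  have hsm : s * sourceMean n Φ ≤ s * (2 * N) := mul_le_mul_of_nonneg_left hm hs
  have hK : -(2 * cellKineticEnergy L Φ.ψ) ≤ kineticStressWave n Φ :=
    (neg_le_neg (abs_kineticStressWave_le n Φ)).trans (neg_abs_le _)
  linarith

/-- **Stub S3a `stub_kineticSignCoherenceBounded` of the skeleton of line
`force-balance-constitutive`**: kinetic sign-coherence at super-healing drives for BOUNDED
admissible potentials, `KinIneq v a(v) M ρ₀ C' N₀` with `ρ₀ = 1`, `N₀ = 0` and `C' = 3M²/(2a(v))`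
if `a(v) > 0` (`stub_kinIneqOfPos`), `C' = 4` if `a(v) = 0` (then `v = 0` a.e., LSSY App. C,
and `kinIneq_of_ae_zero`). [folklore] -/
theorem stub_kineticSignCoherenceBounded : KineticSignCoherenceBounded := by
  intro v hv _ M hM
  obtain ⟨R₀, hR₀⟩ := hv.2
  rcases eq_or_ne (scatteringLength v) 0 with h0 | h0
  · have hv0 : ∀ᵐ x : Space, v ‖x‖ = 0 := LSSY2005_zeroScatteringLength_holds v R₀ hv.1 hR₀ h0
    exact ⟨1, 4, one_pos, by norm_num, 0, kinIneq_of_ae_zero hv.1 hv0 _ M 1 0⟩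
  · have ha : 0 < (scatteringLength v).toReal :=
      ENNReal.toReal_pos h0 (scatteringLength_ne_top_of_finiteRange hR₀)
    exact ⟨1, 3 * M ^ 2 / (2 * (scatteringLength v).toReal), one_pos, by positivity, 0,
      stub_kinIneqOfPos v _ M 1 0 ha hM⟩

/-- **Stub S3b `stub_kineticSignCoherenceUnbounded` of the skeleton of line
`force-balance-constitutive`**: kinetic sign-coherence at super-healing drives for the truncations
`v_t = min(v, t)` of an UNBOUNDED admissible potential, uniformly in `t ≥ t₀ = 0`:
`KinIneq v_t a(v) M 1 C' 0` with `C' = 3M²/(2a(v))` if `a(v) > 0` (`stub_kinIneqOfPos`, which is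
blind to the potential), `C' = 4` if `a(v) = 0` (then `v = 0` a.e., hence `v_t = 0` a.e., and
`kinIneq_of_ae_zero`). [folklore] -/
theorem stub_kineticSignCoherenceUnbounded : KineticSignCoherenceUnbounded := by
  intro v hv _ M hM
  obtain ⟨R₀, hR₀⟩ := hv.2
  rcases eq_or_ne (scatteringLength v) 0 with h0 | h0
  · have hv0 : ∀ᵐ x : Space, v ‖x‖ = 0 := LSSY2005_zeroScatteringLength_holds v R₀ hv.1 hR₀ h0
    refine ⟨1, 4, one_pos, by norm_num, 0, 0, fun t _ => ?_⟩
    exact kinIneq_of_ae_zero (measurable_truncPotential hv.1 t)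
      (hv0.mono fun x hx => truncPotential_eq_zero hx t) _ M 1 0
  · have ha : 0 < (scatteringLength v).toReal :=
      ENNReal.toReal_pos h0 (scatteringLength_ne_top_of_finiteRange hR₀)
    exact ⟨1, 3 * M ^ 2 / (2 * (scatteringLength v).toReal), one_pos, by positivity, 0, 0,
      fun t _ => stub_kinIneqOfPos (truncPotential v t) _ M 1 0 ha hM⟩

end

end Summit.AtomisticToContinuum.BoseEinsteinCondensation.Cruxes.DensityResponse.ForceBalanceConstitutive
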